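import Literature.Barriers.PneNP.TSPExtensionComplexityProofs
import Literature.Barriers.PneNP.TSPExtensionComplexityMatchings
import Literature.Combinatorics.SimpleGraph.CycleSpaceSeparators
import Mathlib.Algebra.BigOperators.Ring.Finset
import HarnessLib

/-!
# Yannakakis' face of the TSP polytope carrying the perfect matchings (odd-cut slack data)

Support file for the Rothvoß bound `Literature.Barriers.PneNP.Rothvoss2017_tsp`
(`xc(TSP(n)) ≥ 2^{Ω(n)}`, Rothvoß 2017, Cor. 2), which is Rothvoß's matching theorem (Thm. 1)
transported along Yannakakis' reduction: "Consider a graph `G` with `6n` nodes which are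
partitioned into three equal size sets `L = {l_1,…,l_2n}`, `M = {m_1,…,m_2n}`,
`R = {r_1,…,r_2n}`. The subsets `L, R` induce complete subgraphs and, in addition, each node
`m_i` is connected to `l_i` and `r_i`. ... Since the nodes `m_i` have degree 2, a Hamilton
circuit of `G` consists of their incident edges and perfect matchings from `L` and `R`. Also,
every perfect matching of `L` can be extended to a Hamilton circuit of `G`. Therefore, the
matching polytope for `L` is a projection of [the face] `TSP(G)`" (Yannakakis 1991, proof of
Thm. 2, p. 454; Rothvoß 2017, §1.1, PDF p. 4).

Rather than through polytope equalities (face, projection), we record the reduction in the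
form the hyperplane-separation argument consumes (`HasEFOfSize.weight_slack_le` of
`…HyperplaneBound.lean`): explicit POINTS of `TSP(N)` indexed by the perfect matchings `M` of
`K_n` and explicit VALID INEQUALITIES indexed by the odd vertex sets `U ⊆ [n]`, whose slack
matrix is exactly Rothvoß's `S_{UM} = |δ(U) ∩ M| - 1` (Rothvoß 2017, §2, PDF p. 5):

* `YV n pad` — the vertices `l i, m i, r i (i < n)` and `pad` extra clique vertices `x t`
  (`|YV n pad| = 3n + pad`, so every `N ≥ 3n` is covered); `yGraph n pad` — Yannakakis' graph
  (`L` a clique, `R ∪ X` a clique, `m i ∼ l i, r i`);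
* for the tree's perfect matchings `IsPMOn univ M` (`…Matchings.lean`): the partner map
  `IsPMOn.partner` and the parity lemma `IsPMOn.exists_crossing` (an odd set is crossed by
  some edge — `Crosses` of `Literature.Combinatorics.SimpleGraph.CycleSpace`);
* tours inside `yGraph` restrict on `L` to perfect matchings (`lMatch`,
  `IsTourOn.isPMOn_lMatch`: degree two at `m i` and at `l i`);
* the designated tour `ypTour M` of a perfect matching (blocks `r a, m a, l a, l a', m a', r a'`
  over the matching edges `{a, a'}`, closed up through the clique `R ∪ X`), with
  `lMatch (ypTour M) = M`;
* the penalised odd-cut functional `ycoeff U` (`-1` on the `L`-edges crossing `U`, `-1` on the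
  non-edges of `yGraph`) with right-hand side `-1`: valid on every tour of the complete graph
  (`sum_ycoeff_le`), with value `-|δ(U) ∩ M|` at `ypTour M` (`sum_ycoeff_ypTour`);
* transported to `Fin (3n + pad)`: `exists_matching_slack_data` — points `v_M ∈ TSP(3n+pad)`,
  valid rows `c_U · x ≤ d_U` (`U` odd) with `d_U - c_U · v_M = |δ(U) ∩ M| - 1`.

## Sources

* [Yannakakis1991] M. Yannakakis, *Expressing combinatorial optimization problems by linear
  programs*, JCSS 43 (1991) 441–466 (held as the STOC 1988 text, doi:10.1145/62212.62232, with
  the JCSS pagination): Thm. 2 and its proof, p. 454.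
* [Rothvoss2017] arXiv:1311.2369 (held): §1.1 (PDF p. 4: "a linear projection of a face of the
  TSP polytope in an `O(n)`-node graph to the perfect matching polytope"), Cor. 2; §2 (PDF p. 5:
  the slack matrix `S_{UM} = |M ∩ δ(U)| - 1` of the odd-set inequalities).
-/

namespace Literature.Barriers.PneNP

open Finset SimpleGraph Literature.Combinatorics.SimpleGraph.CycleSpace

/-! ### Perfect matchings of the complete graph: partners and parity -/

section PerfectMatching

variable {α : Type*} [Fintype α] [DecidableEq α]

omit [Fintype α] [DecidableEq α] in
/-- An unordered pair crosses `U` iff it is `{a, b}` with `a ∈ U`, `b ∉ U` (the existential form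
of `Literature.Combinatorics.SimpleGraph.CycleSpace.Crosses`, i.e. `e ∈ δ(U)`). [folklore] -/
theorem crosses_iff_exists {U : Finset α} {e : Sym2 α} :
    Crosses U e ↔ ∃ a b, e = s(a, b) ∧ a ∈ U ∧ b ∉ U := by
  induction e using Sym2.ind with
  | h x y =>
    rw [crosses_mk]
    constructor
    · rintro (⟨hx, hy⟩ | ⟨hx, hy⟩)
      · exact ⟨x, y, rfl, hx, hy⟩
      · exact ⟨y, x, Sym2.eq_swap, hy, hx⟩
    · rintro ⟨a, b, h, ha, hb⟩
      rcases Sym2.eq_iff.1 h with ⟨rfl, rfl⟩ | ⟨rfl, rfl⟩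
      · exact Or.inl ⟨ha, hb⟩
      · exact Or.inr ⟨hb, ha⟩

/-- A perfect matching of the whole (finite) vertex type from the "exactly one partner"
description: no loops and `∀ v, ∃! w, {v, w} ∈ M` give `IsPMOn univ M` (the tree's edge-set
notion of perfect matching, `TSPExtensionComplexityMatchings.lean`). [folklore] -/
theorem isPMOn_univ_of_existsUnique {M : Finset (Sym2 α)} (hd : ∀ e ∈ M, ¬e.IsDiag)
    (hu : ∀ v, ∃! w, s(v, w) ∈ M) : IsPMOn (Finset.univ : Finset α) M := by
  refine ⟨fun e _ => by simp, hd, fun v _ => ?_⟩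
  obtain ⟨w, hw, huniq⟩ := hu v
  rw [card_eq_one]
  refine ⟨s(v, w), ?_⟩
  ext e
  simp only [mem_filter, mem_singleton]
  constructor
  · rintro ⟨he, hve⟩
    have h1 : e = s(v, Sym2.Mem.other hve) := (Sym2.other_spec hve).symm
    rw [h1] at he ⊢
    rw [huniq _ he]
  · rintro rfl
    exact ⟨hw, Sym2.mem_mk_left _ _⟩

namespace IsPMOn

variable {M : Finset (Sym2 α)} (hM : IsPMOn (Finset.univ : Finset α) M)
include hM

/-- Every vertex has exactly one partner. [folklore] -/
theorem existsUnique_mk_mem (v : α) : ∃! w, s(v, w) ∈ M := by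
  obtain ⟨e, he, hve⟩ := hM.exists_mem (mem_univ v)
  refine ⟨Sym2.Mem.other hve, ?_, fun w hw => ?_⟩
  · show s(v, Sym2.Mem.other hve) ∈ M
    rwa [Sym2.other_spec hve]
  have heq : s(v, w) = e := hM.unique hw he (Sym2.mem_mk_left _ _) hve
  have : w ∈ e := heq ▸ Sym2.mem_mk_right _ _
  rcases Sym2.mem_iff.1 (show w ∈ s(v, Sym2.Mem.other hve) by rwa [Sym2.other_spec hve])
    with h | h
  · -- `w = v`: then `e = {v, v}` would be a loop
    subst h
    exfalso
    exact hM.not_isDiag he (by rw [← heq]; exact Sym2.mk_isDiag_iff.2 rfl)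
  · exact h

/-- The partner of a vertex in a perfect matching. [folklore] -/
noncomputable def partner (v : α) : α := (hM.existsUnique_mk_mem v).exists.choose

/-- `{v, partner v} ∈ M`. [folklore] -/
theorem mk_partner_mem (v : α) : s(v, hM.partner v) ∈ M :=
  (hM.existsUnique_mk_mem v).exists.choose_spec

/-- The partner is the only neighbour. [folklore] -/
theorem eq_partner_of_mem {v w : α} (h : s(v, w) ∈ M) : w = hM.partner v :=
  (hM.existsUnique_mk_mem v).unique h (hM.mk_partner_mem v)

/-- No vertex is its own partner. [folklore] -/
theorem partner_ne (v : α) : hM.partner v ≠ v := by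
  intro h
  have := hM.mk_partner_mem v
  rw [h] at this
  exact hM.not_isDiag this (Sym2.mk_isDiag_iff.2 rfl)

/-- The partner map is an involution. [folklore] -/
theorem partner_partner (v : α) : hM.partner (hM.partner v) = v := by
  refine (hM.eq_partner_of_mem ?_).symm
  rw [Sym2.eq_swap]
  exact hM.mk_partner_mem v

/-- Every matching edge is `{v, partner v}`. [folklore] -/
theorem eq_mk_partner_of_mem {e : Sym2 α} (he : e ∈ M) {v : α} (hv : v ∈ e) :
    e = s(v, hM.partner v) := by
  have h1 : e = s(v, Sym2.Mem.other hv) := (Sym2.other_spec hv).symm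
  rw [h1] at he ⊢
  rw [hM.eq_partner_of_mem he]

/-- **Parity lemma**: a perfect matching crosses every odd vertex set ("for parity reasons",
the validity of the odd-set inequalities `x(δ(U)) ≥ 1`). [cite: Rothvoss2017, §1 (PDF p. 4)] -/
theorem exists_crossing {U : Finset α} (hU : Odd U.card) : ∃ e ∈ M, Crosses U e := by
  by_contra hno
  push Not at hno
  -- every vertex of `U` is matched inside `U`
  have hin : ∀ v ∈ U, hM.partner v ∈ U := by
    intro v hv
    by_contra hout
    exact hno _ (hM.mk_partner_mem v) ((crosses_mk U _ _).2 (Or.inl ⟨hv, hout⟩))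
  -- so `U` is the disjoint union of the fibres of `v ↦ {v, partner v}`, each of size two
  let f : α → Sym2 α := fun v => s(v, hM.partner v)
  have hcard := Finset.card_eq_sum_card_fiberwise (f := f) (s := U) (t := U.image f)
    (fun v hv => mem_image_of_mem f hv)
  have htwo : ∀ e ∈ U.image f, (U.filter fun v => f v = e).card = 2 := by
    intro e he
    obtain ⟨v, hv, rfl⟩ := mem_image.1 he
    have hset : (U.filter fun w => f w = f v) = {v, hM.partner v} := by
      ext w
      simp only [mem_filter, mem_insert, mem_singleton, f]
      constructor
      · rintro ⟨-, h⟩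
        have hw : w ∈ s(v, hM.partner v) := by rw [← h]; exact Sym2.mem_mk_left _ _
        exact Sym2.mem_iff.1 hw
      · rintro (rfl | rfl)
        · exact ⟨hv, rfl⟩
        · refine ⟨hin v hv, ?_⟩
          rw [hM.partner_partner, Sym2.eq_swap]
    rw [hset, card_pair (hM.partner_ne v).symm]
  rw [sum_congr rfl htwo, sum_const, smul_eq_mul] at hcard
  exact (Nat.not_even_iff_odd.2 hU) ⟨(U.image f).card, by omega⟩

end IsPMOn

end PerfectMatching

/-! ### Yannakakis' graph -/

/-- Vertices of Yannakakis' graph with parameters `n` (the matching side) and `pad` (extra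
clique vertices): `l i`, `m i`, `r i` for `i < n` and `x t` for `t < pad`.
[cite: Yannakakis1991, proof of Thm. 2 (p. 454)] -/
inductive YV (n pad : ℕ) : Type
  /-- the side `L`, carrying the perfect matchings -/
  | l (i : Fin n)
  /-- the middle vertices `m i ∼ l i, r i` of degree two -/
  | m (i : Fin n)
  /-- the side `R` (a clique) -/
  | r (i : Fin n)
  /-- padding vertices, inside the clique of `R` -/
  | x (t : Fin pad)
  deriving DecidableEq

namespace YV

variable {n pad : ℕ}

/-- `YV n pad` as a sum type. [folklore] -/
def equivSum : YV n pad ≃ Fin n ⊕ Fin n ⊕ Fin n ⊕ Fin pad where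
  toFun
    | l i => Sum.inl i
    | m i => Sum.inr (Sum.inl i)
    | r i => Sum.inr (Sum.inr (Sum.inl i))
    | x t => Sum.inr (Sum.inr (Sum.inr t))
  invFun
    | Sum.inl i => l i
    | Sum.inr (Sum.inl i) => m i
    | Sum.inr (Sum.inr (Sum.inl i)) => r i
    | Sum.inr (Sum.inr (Sum.inr t)) => x t
  left_inv v := by cases v <;> rfl
  right_inv w := by rcases w with i | i | i | t <;> rfl

/-- `YV n pad` is finite. [folklore] -/
instance : Fintype (YV n pad) := Fintype.ofEquiv _ equivSum.symm

/-- `|YV n pad| = 3n + pad`. [cite: Yannakakis1991, proof of Thm. 2 (p. 454: "a graph G with 6n nodes")] -/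
theorem card (n pad : ℕ) : Fintype.card (YV n pad) = 3 * n + pad := by
  rw [Fintype.card_congr (equivSum (n := n) (pad := pad))]
  simp only [Fintype.card_sum, Fintype.card_fin]
  ring

/-- The clique side `R ∪ X`. [folklore] -/
def inR : YV n pad → Prop
  | r _ => True
  | x _ => True
  | _ => False

/-- The generating relation of Yannakakis' graph: `L` a clique, `R ∪ X` a clique, `m i ∼ l i`,
`m i ∼ r i`. [cite: Yannakakis1991, proof of Thm. 2 (p. 454)] -/
def rel : YV n pad → YV n pad → Prop
  | l _, l _ => True
  | m i, l j => i = j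
  | m i, r j => i = j
  | v, w => inR v ∧ inR w

end YV

open YV

variable {n pad : ℕ}

/-- **Yannakakis' graph** on `YV n pad`. [cite: Yannakakis1991, proof of Thm. 2 (p. 454)] -/
def yGraph (n pad : ℕ) : SimpleGraph (YV n pad) := SimpleGraph.fromRel YV.rel

/-- Adjacency in Yannakakis' graph is decidable (classically; used for the penalty term).
[folklore] -/
noncomputable instance : DecidableRel (yGraph n pad).Adj := Classical.decRel _

/-- The neighbours of `m i` are `l i` and `r i`. [cite: Yannakakis1991, proof of Thm. 2 (p. 454: "the nodes m_i have degree 2")] -/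
theorem yGraph_adj_m_iff (i : Fin n) (w : YV n pad) :
    (yGraph n pad).Adj (m i) w ↔ w = l i ∨ w = r i := by
  rw [yGraph, fromRel_adj]
  cases w with
  | l j => simp [YV.rel, YV.inR, eq_comm]
  | m j => simp [YV.rel, YV.inR]
  | r j => simp [YV.rel, YV.inR, eq_comm]
  | x t => simp [YV.rel, YV.inR]

/-- The neighbours of `l i` are the other `l j` and `m i`. [cite: Yannakakis1991, proof of Thm. 2 (p. 454)] -/
theorem yGraph_adj_l_iff (i : Fin n) (w : YV n pad) :
    (yGraph n pad).Adj (l i) w ↔ (∃ j, j ≠ i ∧ w = l j) ∨ w = m i := by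
  rw [yGraph, fromRel_adj]
  cases w with
  | l j => simp [YV.rel, eq_comm]
  | m j => simp [YV.rel, YV.inR, eq_comm]
  | r j => simp [YV.rel, YV.inR]
  | x t => simp [YV.rel, YV.inR]

/-- `l i ∼ l j` for `i ≠ j`. [folklore] -/
theorem yGraph_adj_l_l {i j : Fin n} (h : i ≠ j) : (yGraph n pad).Adj (l i) (l j) :=
  (yGraph_adj_l_iff i _).2 (Or.inl ⟨j, h.symm, rfl⟩)

/-- `l i ∼ m i`. [folklore] -/
theorem yGraph_adj_l_m (i : Fin n) : (yGraph n pad).Adj (l i) (m i) :=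
  (yGraph_adj_l_iff i _).2 (Or.inr rfl)

/-- `m i ∼ r i`. [folklore] -/
theorem yGraph_adj_m_r (i : Fin n) : (yGraph n pad).Adj (m i) (r i : YV n pad) :=
  (yGraph_adj_m_iff i _).2 (Or.inr rfl)

/-- Distinct vertices of the clique side `R ∪ X` are adjacent. [folklore] -/
theorem yGraph_adj_of_inR {v w : YV n pad} (hv : inR v) (hw : inR w) (hne : v ≠ w) :
    (yGraph n pad).Adj v w := by
  rw [yGraph, fromRel_adj]
  refine ⟨hne, Or.inl ?_⟩
  cases v with
  | l _ => exact hv.elim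
  | m _ => exact hv.elim
  | r i => cases w with
    | l _ => exact hw.elim
    | m _ => exact hw.elim
    | r j => exact ⟨trivial, trivial⟩
    | x t => exact ⟨trivial, trivial⟩
  | x s => cases w with
    | l _ => exact hw.elim
    | m _ => exact hw.elim
    | r j => exact ⟨trivial, trivial⟩
    | x t => exact ⟨trivial, trivial⟩

/-! ### Tours inside Yannakakis' graph restrict to perfect matchings of `L` -/

/-- The matching of `K_n` induced on the side `L` by an edge set of Yannakakis' graph:
`{i, j} ↦ {l i, l j}`. [cite: Yannakakis1991, proof of Thm. 2 (p. 454: "perfect matchings from L")] -/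
noncomputable def lMatch (T : Finset (Sym2 (YV n pad))) : Finset (Sym2 (Fin n)) :=
  Finset.univ.filter fun e => ¬e.IsDiag ∧ Sym2.map YV.l e ∈ T

/-- Membership in `lMatch`. [folklore] -/
theorem mk_mem_lMatch_iff {T : Finset (Sym2 (YV n pad))} {i j : Fin n} :
    s(i, j) ∈ lMatch T ↔ i ≠ j ∧ s(l i, l j) ∈ T := by
  simp [lMatch]

variable {T : Finset (Sym2 (YV n pad))}

/-- A tour inside Yannakakis' graph uses both edges at each middle vertex.
[cite: Yannakakis1991, proof of Thm. 2 (p. 454)] -/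
theorem IsTourOn.mk_m_mem (hT : IsTourOn T) (hTG : ∀ e ∈ T, e ∈ (yGraph n pad).edgeSet)
    (i : Fin n) : s(m i, l i) ∈ T ∧ s(m i, r i) ∈ T :=
  hT.both_mem hTG fun w hw => (yGraph_adj_m_iff i w).1 hw

/-- **A tour inside Yannakakis' graph restricts to a perfect matching of `L`.**
[cite: Yannakakis1991, proof of Thm. 2 (p. 454: "a Hamilton circuit of G consists of their incident edges and perfect matchings from L and R")] -/
theorem IsTourOn.isPMOn_lMatch (hT : IsTourOn T)
    (hTG : ∀ e ∈ T, e ∈ (yGraph n pad).edgeSet) :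
    IsPMOn (Finset.univ : Finset (Fin n)) (lMatch T) := by
  classical
  refine isPMOn_univ_of_existsUnique (fun e he => ?_) (fun i => ?_)
  · exact ((mem_filter.1 he).2).1
  · -- the two tour edges at `l i`: `{m i, l i}` and one more, which must go into `L`
    have hml : s(m i, l i) ∈ T := (hT.mk_m_mem hTG i).1
    have h2 := hT.card_filter_mem (l i)
    obtain ⟨e₁, e₂, hne, hpair⟩ := card_eq_two.1 h2
    have he₁ : e₁ ∈ T.filter fun e => l i ∈ e := by rw [hpair]; simp
    have he₂ : e₂ ∈ T.filter fun e => l i ∈ e := by rw [hpair]; simp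
    -- one of them differs from `{m i, l i}`
    obtain ⟨e, he, hem⟩ : ∃ e ∈ T.filter (fun e => l i ∈ e), e ≠ s(m i, l i) := by
      by_cases h : e₁ = s(m i, l i)
      · exact ⟨e₂, he₂, fun h' => hne (h.trans h'.symm)⟩
      · exact ⟨e₁, he₁, h⟩
    rw [mem_filter] at he
    obtain ⟨w, hw, rfl⟩ := edge_eq_of_supported hTG he.1 he.2
    rcases (yGraph_adj_l_iff i w).1 hw with ⟨j, hji, rfl⟩ | rfl
    · refine ⟨j, mk_mem_lMatch_iff.2 ⟨hji.symm, he.1⟩, fun j' hj' => ?_⟩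
      simp only [mk_mem_lMatch_iff] at hj'
      -- a third edge at `l i` is impossible
      have hne' : (s(m i, l i) : Sym2 (YV n pad)) ≠ s(l i, l j) := by
        intro h
        have : m i ∈ s(l i, l j) := h ▸ Sym2.mem_mk_left _ _
        rcases Sym2.mem_iff.1 this with h' | h' <;> cases h'
      rcases hT.eq_or_eq_of_mem hml he.1 hne' (Sym2.mem_mk_right _ _) (Sym2.mem_mk_left _ _)
        hj'.2 (Sym2.mem_mk_left _ _) with h | h
      · have : l j' ∈ s(m i, l i) := h ▸ Sym2.mem_mk_right _ _
        rcases Sym2.mem_iff.1 this with h' | h'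
        · cases h'
        · cases h'
          exact absurd rfl hj'.1
      · have : l j' ∈ s(l i, l j) := h ▸ Sym2.mem_mk_right _ _
        rcases Sym2.mem_iff.1 this with h' | h'
        · cases h'
          exact absurd rfl hj'.1
        · cases h'
          rfl
    · exact absurd Sym2.eq_swap hem

/-- Consequently a tour inside Yannakakis' graph has an `L`-edge across every odd `U ⊆ [n]`.
[cite: Rothvoss2017, §1 (PDF p. 4: the odd-set inequalities)] -/
theorem IsTourOn.exists_lMatch_crossing (hT : IsTourOn T)
    (hTG : ∀ e ∈ T, e ∈ (yGraph n pad).edgeSet) {U : Finset (Fin n)} (hU : Odd U.card) :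
    ∃ e ∈ lMatch T, Crosses U e :=
  (hT.isPMOn_lMatch hTG).exists_crossing hU

/-! ### The designated tour of a perfect matching -/

section Designated

variable {M : Finset (Sym2 (Fin n))} (hM : IsPMOn (Finset.univ : Finset (Fin n)) M)
include hM

/-- The smaller end of the matching edge through `i`. [folklore] -/
noncomputable def IsPMOn.key (i : Fin n) : Fin n :=
  if i < hM.partner i then i else hM.partner i

/-- `key i < partner (key i)`. [folklore] -/
theorem IsPMOn.key_lt (i : Fin n) : hM.key i < hM.partner (hM.key i) := by
  unfold IsPMOn.key
  split_ifs with h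
  · exact h
  · rw [hM.partner_partner]
    exact lt_of_le_of_ne (not_lt.1 h) (hM.partner_ne i)

/-- `i` is `key i` or its partner. [folklore] -/
theorem IsPMOn.eq_key_or (i : Fin n) : i = hM.key i ∨ i = hM.partner (hM.key i) := by
  unfold IsPMOn.key
  split_ifs
  · exact Or.inl rfl
  · rw [hM.partner_partner]; exact Or.inr rfl

/-- `key (partner i) = key i`. [folklore] -/
theorem IsPMOn.key_partner (i : Fin n) : hM.key (hM.partner i) = hM.key i := by
  unfold IsPMOn.key
  rw [hM.partner_partner]
  by_cases h : i < hM.partner i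
  · rw [if_pos h, if_neg (not_lt.2 h.le)]
  · rw [if_neg h]
    have : hM.partner i < i := lt_of_le_of_ne (not_lt.1 h) (hM.partner_ne i)
    rw [if_pos this]

/-- A key is its own key. [folklore] -/
theorem IsPMOn.key_eq_self_of_lt {a : Fin n} (ha : a < hM.partner a) : hM.key a = a := by
  unfold IsPMOn.key
  rw [if_pos ha]

variable (pad)

/-- The blocks of the designated tour, keyed by vertices: the key `r a` (`a < a' := partner a`)
owns `[r a, m a, l a, l a', m a', r a']`, a padding vertex owns itself, nothing else owns.
[cite: Yannakakis1991, proof of Thm. 2 (p. 454: "every perfect matching of L can be extended to a Hamilton circuit of G")] -/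
noncomputable def yBlk : YV n pad → List (YV n pad)
  | r a => if a < hM.partner a then
      [r a, m a, l a, l (hM.partner a), m (hM.partner a), r (hM.partner a)] else []
  | x t => [x t]
  | _ => []

/-- The owner of a vertex: `r (key i)` for `l i, m i, r i`; a padding vertex owns itself.
[folklore] -/
noncomputable def yOwner : YV n pad → YV n pad
  | l i => r (hM.key i)
  | m i => r (hM.key i)
  | r i => r (hM.key i)
  | x t => x t

/-- The vertex sequence of the designated tour of `M`. [folklore] -/
noncomputable def ypList : List (YV n pad) :=
  (Finset.univ : Finset (YV n pad)).toList.flatMap (yBlk pad hM)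

/-- **The designated tour `T_M`** of the perfect matching `M` (an edge set of the complete
graph on `YV n pad`). [cite: Yannakakis1991, proof of Thm. 2 (p. 454)] -/
noncomputable def ypTour : Finset (Sym2 (YV n pad)) := cycEdges (ypList pad hM)

variable {pad}

/-- The block of a key, unfolded. [folklore] -/
theorem yBlk_key (i : Fin n) : yBlk pad hM (r (hM.key i)) =
    [r (hM.key i), m (hM.key i), l (hM.key i), l (hM.partner (hM.key i)),
      m (hM.partner (hM.key i)), r (hM.partner (hM.key i))] := by
  simp only [yBlk, if_pos (hM.key_lt i)]

/-- Every vertex lies in the block of its owner. [folklore] -/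
theorem mem_yBlk_yOwner (v : YV n pad) : v ∈ yBlk pad hM (yOwner pad hM v) := by
  cases v with
  | l i =>
    simp only [yOwner, yBlk_key]
    rcases hM.eq_key_or i with h | h
    · rw [← h]; simp
    · rw [← h]; simp
  | m i =>
    simp only [yOwner, yBlk_key]
    rcases hM.eq_key_or i with h | h
    · rw [← h]; simp
    · rw [← h]; simp
  | r i =>
    simp only [yOwner, yBlk_key]
    rcases hM.eq_key_or i with h | h
    · rw [← h]; simp
    · rw [← h]; simp
  | x t => simp [yOwner, yBlk]

/-- A vertex lies only in the block of its owner. [folklore] -/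
theorem yOwner_eq_of_mem_yBlk {v u : YV n pad} (h : v ∈ yBlk pad hM u) : yOwner pad hM v = u := by
  cases u with
  | l j => simp [yBlk] at h
  | m j => simp [yBlk] at h
  | r a =>
    by_cases ha : a < hM.partner a
    · have hka : hM.key a = a := hM.key_eq_self_of_lt ha
      have hkp : hM.key (hM.partner a) = a := by rw [hM.key_partner, hka]
      simp only [yBlk, if_pos ha, List.mem_cons, List.not_mem_nil, or_false] at h
      rcases h with rfl | rfl | rfl | rfl | rfl | rfl <;> simp [yOwner, hka, hkp]
    · simp [yBlk, if_neg ha] at h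
  | x t =>
    simp only [yBlk, List.mem_singleton] at h
    subst h
    rfl

/-- Every vertex is listed. [folklore] -/
theorem mem_ypList (v : YV n pad) : v ∈ ypList pad hM :=
  List.mem_flatMap.2 ⟨yOwner pad hM v, Finset.mem_toList.2 (mem_univ _), mem_yBlk_yOwner hM v⟩

/-- Distinct keys have disjoint blocks. [folklore] -/
theorem disjoint_yBlk {u u' : YV n pad} (h : u ≠ u') :
    List.Disjoint (yBlk pad hM u) (yBlk pad hM u') :=
  fun _ hv hv' => h ((yOwner_eq_of_mem_yBlk hM hv).symm.trans (yOwner_eq_of_mem_yBlk hM hv'))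

/-- Blocks have no repetition. [folklore] -/
theorem nodup_yBlk (u : YV n pad) : (yBlk pad hM u).Nodup := by
  cases u with
  | l j => simp [yBlk]
  | m j => simp [yBlk]
  | r a =>
    by_cases ha : a < hM.partner a
    · have hne : a ≠ hM.partner a := ha.ne
      simp [yBlk, if_pos ha, hne]
    · simp [yBlk, if_neg ha]
  | x t => simp [yBlk]

/-- No vertex is listed twice. [folklore] -/
theorem nodup_ypList : (ypList pad hM).Nodup := by
  rw [ypList, List.nodup_flatMap]
  refine ⟨fun u _ => nodup_yBlk hM u, ?_⟩
  exact (Finset.nodup_toList _).pairwise_of_forall_ne fun u _ u' _ h => disjoint_yBlk hM h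

/-- The length of the vertex sequence is `3n + pad`. [folklore] -/
theorem length_ypList : (ypList pad hM).length = 3 * n + pad := by
  rw [← YV.card n pad, ← List.toFinset_card_of_nodup (nodup_ypList hM), ← Finset.card_univ]
  congr 1
  exact eq_univ_iff_forall.2 fun v => List.mem_toFinset.2 (mem_ypList hM v)

/-- A nonempty block starts in the clique `R ∪ X`. [folklore] -/
theorem inR_head_yBlk {u : YV n pad} (h : yBlk pad hM u ≠ []) : inR ((yBlk pad hM u).head h) := by
  cases u with
  | l j => simp [yBlk] at h
  | m j => simp [yBlk] at h
  | r a =>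
    by_cases ha : a < hM.partner a
    · simp [yBlk, if_pos ha, YV.inR]
    · simp [yBlk, if_neg ha] at h
  | x t => simp [yBlk, YV.inR]

/-- A nonempty block ends in the clique `R ∪ X`. [folklore] -/
theorem inR_getLast_yBlk {u : YV n pad} (h : yBlk pad hM u ≠ []) :
    inR ((yBlk pad hM u).getLast h) := by
  cases u with
  | l j => simp [yBlk] at h
  | m j => simp [yBlk] at h
  | r a =>
    by_cases ha : a < hM.partner a
    · simp [yBlk, if_pos ha, YV.inR]
    · simp [yBlk, if_neg ha] at h
  | x t => simp [yBlk, YV.inR]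

/-- Each block is a path of Yannakakis' graph. [folklore] -/
theorem isChain_yBlk (u : YV n pad) : List.IsChain (yGraph n pad).Adj (yBlk pad hM u) := by
  cases u with
  | l j => simp [yBlk]
  | m j => simp [yBlk]
  | r a =>
    by_cases ha : a < hM.partner a
    · simp only [yBlk, if_pos ha]
      refine List.IsChain.cons_cons (yGraph_adj_m_r a).symm
        (List.IsChain.cons_cons (yGraph_adj_l_m a).symm
          (List.IsChain.cons_cons (yGraph_adj_l_l ha.ne)
            (List.IsChain.cons_cons (yGraph_adj_l_m _)
              (List.isChain_pair.2 (yGraph_adj_m_r _)))))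
    · simp [yBlk, if_neg ha]
  | x t => simp [yBlk]

/-- The vertex sequence is a path of Yannakakis' graph (block junctions are clique edges).
[folklore] -/
theorem isChain_ypList : List.IsChain (yGraph n pad).Adj (ypList pad hM) := by
  classical
  rw [ypList, List.flatMap_def, ← List.flatten_filter_ne_nil]
  rw [List.isChain_flatten (by simp)]
  refine ⟨fun lst hl => ?_, ?_⟩
  · obtain ⟨hl, -⟩ := List.mem_filter.1 hl
    obtain ⟨u, -, rfl⟩ := List.mem_map.1 hl
    exact isChain_yBlk hM u
  · refine List.Pairwise.isChain (List.Pairwise.filter _ ?_)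
    rw [List.pairwise_map]
    refine (Finset.nodup_toList _).pairwise_of_forall_ne fun u _ u' _ hne => ?_
    intro v hv w hw
    have hne1 : yBlk pad hM u ≠ [] := by rintro h; simp [h] at hv
    have hne2 : yBlk pad hM u' ≠ [] := by rintro h; simp [h] at hw
    rw [List.getLast?_eq_some_getLast hne1] at hv
    rw [List.head?_eq_some_head hne2] at hw
    simp only [Option.mem_def, Option.some.injEq] at hv hw
    subst hv; subst hw
    refine yGraph_adj_of_inR (inR_getLast_yBlk hM hne1) (inR_head_yBlk hM hne2) fun heq => ?_
    have h1 : (yBlk pad hM u).getLast hne1 ∈ yBlk pad hM u := List.getLast_mem hne1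
    have h2 : (yBlk pad hM u').head hne2 ∈ yBlk pad hM u' := List.head_mem hne2
    rw [heq] at h1
    exact disjoint_yBlk hM hne h1 h2

/-- [folklore] -/
theorem ypList_ne_nil (hn : 0 < n) : ypList pad hM ≠ [] := by
  intro h
  have := length_ypList (pad := pad) hM
  rw [h, List.length_nil] at this
  omega

/-- The sequence starts in the clique `R ∪ X`. [folklore] -/
theorem inR_head_ypList (h : ypList pad hM ≠ []) : inR ((ypList pad hM).head h) := by
  have h' : ((univ : Finset (YV n pad)).toList.map (yBlk pad hM)).flatten ≠ [] := by
    rwa [← List.flatMap_def]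
  obtain ⟨lst, hl, hne, heq⟩ := head_flatten_mem _ h'
  obtain ⟨u, -, rfl⟩ := List.mem_map.1 hl
  have : (ypList pad hM).head h = (yBlk pad hM u).head hne := by
    rw [← heq]; congr 1
  rw [this]
  exact inR_head_yBlk hM hne

/-- The sequence ends in the clique `R ∪ X`. [folklore] -/
theorem inR_getLast_ypList (h : ypList pad hM ≠ []) : inR ((ypList pad hM).getLast h) := by
  have h' : ((univ : Finset (YV n pad)).toList.map (yBlk pad hM)).flatten ≠ [] := by
    rwa [← List.flatMap_def]
  obtain ⟨lst, hl, hne, heq⟩ := getLast_flatten_mem _ h'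
  obtain ⟨u, -, rfl⟩ := List.mem_map.1 hl
  have : (ypList pad hM).getLast h = (yBlk pad hM u).getLast hne := by
    rw [← heq]; congr 1
  rw [this]
  exact inR_getLast_yBlk hM hne

/-- The sequence closes up through a clique edge. [folklore] -/
theorem adj_getLast_head_ypList (hn : 0 < n) :
    (yGraph n pad).Adj ((ypList pad hM).getLast (ypList_ne_nil hM hn))
      ((ypList pad hM).head (ypList_ne_nil hM hn)) :=
  yGraph_adj_of_inR (inR_getLast_ypList hM _) (inR_head_ypList hM _)
    (getLast_ne_head_of_nodup _ _ (nodup_ypList hM)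
      (by have := length_ypList (pad := pad) hM; omega))

/-- **`T_M` is a tour.** [cite: Yannakakis1991, proof of Thm. 2 (p. 454)] -/
theorem isTourOn_ypTour (hn : 0 < n) : IsTourOn (ypTour pad hM) :=
  isTourOn_cycEdges (nodup_ypList hM) (mem_ypList hM)
    (by have := length_ypList (pad := pad) hM; omega)

/-- **`T_M` lies inside Yannakakis' graph.** [cite: Yannakakis1991, proof of Thm. 2 (p. 454)] -/
theorem ypTour_subset (hn : 0 < n) : ∀ e ∈ ypTour pad hM, e ∈ (yGraph n pad).edgeSet :=
  cycEdges_subset_edgeSet (ypList_ne_nil hM hn) (isChain_ypList hM) (adj_getLast_head_ypList hM hn)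

/-- Every block is a contiguous piece of the sequence. [folklore] -/
theorem yBlk_infix (u : YV n pad) : ∃ pre post, ypList pad hM = pre ++ yBlk pad hM u ++ post := by
  obtain ⟨s, t, hst⟩ := List.append_of_mem (Finset.mem_toList.2 (mem_univ u))
  refine ⟨s.flatMap (yBlk pad hM), t.flatMap (yBlk pad hM), ?_⟩
  rw [ypList, hst, List.flatMap_append, List.flatMap_cons, List.append_assoc]

/-- The matching edges are `L`-edges of `T_M`. [folklore] -/
theorem mk_l_mem_ypTour (i : Fin n) : s(l i, l (hM.partner i)) ∈ ypTour pad hM := by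
  -- the block of `key i` contains `l (key i), l (partner (key i))` consecutively
  obtain ⟨pre, post, hl⟩ := yBlk_infix hM (r (hM.key i) : YV n pad)
  have hmem : s(l (hM.key i), l (hM.partner (hM.key i))) ∈ ypTour pad hM := by
    rw [ypTour, hl, yBlk_key]
    have : pre ++ [r (hM.key i), m (hM.key i), l (hM.key i), l (hM.partner (hM.key i)),
        m (hM.partner (hM.key i)), r (hM.partner (hM.key i))] ++ post =
        (pre ++ [r (hM.key i), m (hM.key i)]) ++ l (hM.key i) :: l (hM.partner (hM.key i)) ::
          ([m (hM.partner (hM.key i)), r (hM.partner (hM.key i))] ++ post) := by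
      simp [List.append_assoc]
    rw [this]
    exact mem_cycEdges_append _ _ _ _
  rcases hM.eq_key_or i with h | h
  · rw [← h] at hmem; exact hmem
  · have h2 : hM.partner i = hM.key i := by
      conv_lhs => rw [h]
      exact hM.partner_partner _
    have h3 : (l i : YV n pad) = l (hM.partner (hM.key i)) := by rw [← h]
    rw [h2, Sym2.eq_swap, h3]
    exact hmem

/-- **`T_M` restricts to `M` on the side `L`.** [cite: Yannakakis1991, proof of Thm. 2 (p. 454)] -/
theorem lMatch_ypTour (hn : 0 < n) : lMatch (ypTour pad hM) = M := by
  ext e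
  induction e using Sym2.ind with
  | h i j =>
    rw [mk_mem_lMatch_iff]
    constructor
    · rintro ⟨hij, hT⟩
      -- `l i` has only one `L`-partner in the tour `T_M`, namely `l (partner i)`
      have hpm := (isTourOn_ypTour (pad := pad) hM hn).isPMOn_lMatch
        (ypTour_subset hM hn)
      have h1 : s(i, j) ∈ lMatch (ypTour pad hM) := mk_mem_lMatch_iff.2 ⟨hij, hT⟩
      have h2 : s(i, hM.partner i) ∈ lMatch (ypTour pad hM) :=
        mk_mem_lMatch_iff.2 ⟨(hM.partner_ne i).symm, mk_l_mem_ypTour hM i⟩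
      have := (hpm.existsUnique_mk_mem i).unique h1 h2
      rw [this]
      exact hM.mk_partner_mem i
    · intro h
      have hj : j = hM.partner i := hM.eq_partner_of_mem h
      subst hj
      exact ⟨(hM.partner_ne i).symm, mk_l_mem_ypTour hM i⟩

end Designated

/-! ### The penalised odd-cut inequalities and their slacks -/

section OddCut

/-- The `L`-edges crossing `U`: `{ {l a, l b} : {a, b} ∈ δ(U) }`. [cite: Rothvoss2017, §1 (PDF p. 4)] -/
noncomputable def lCut (U : Finset (Fin n)) : Finset (Sym2 (YV n pad)) :=
  (Finset.univ.filter (Crosses U)).image (Sym2.map YV.l)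

/-- Membership in `lCut`. [folklore] -/
theorem mem_lCut_iff {U : Finset (Fin n)} {e : Sym2 (YV n pad)} :
    e ∈ lCut U ↔ ∃ a b, a ∈ U ∧ b ∉ U ∧ e = s(l a, l b) := by
  simp only [lCut, mem_image, mem_filter, mem_univ, true_and, crosses_iff_exists]
  constructor
  · rintro ⟨e', ⟨a, b, rfl, ha, hb⟩, rfl⟩
    exact ⟨a, b, ha, hb, by simp⟩
  · rintro ⟨a, b, ha, hb, rfl⟩
    exact ⟨s(a, b), ⟨a, b, rfl, ha, hb⟩, by simp⟩

variable (pad) in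
/-- The coefficients of the **penalised odd-cut inequality** of `U` on the edges of the complete
graph on `YV n pad`: `-1` on the `L`-edges crossing `U`, `-1` on the non-edges of Yannakakis'
graph, `0` elsewhere; with right-hand side `-1` this is `x(δ_L(U)) + x(E ∖ E(G)) ≥ 1`, the odd-set
inequality `x(δ(U)) ≥ 1` of the face `TSP(G)` made valid on all of `TSP`.
[cite: Rothvoss2017, §1–2 (PDF pp. 4–5)] -/
noncomputable def ycoeff (U : Finset (Fin n)) (e : Sym2 (YV n pad)) : ℝ :=
  -((if e ∈ lCut U then 1 else 0) + (if e ∉ (yGraph n pad).edgeSet then 1 else 0))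

/-- The functional of `U` on an edge set counts crossing `L`-edges and penalty edges. [folklore] -/
theorem sum_ycoeff (U : Finset (Fin n)) (T : Finset (Sym2 (YV n pad))) :
    ∑ e ∈ T, ycoeff pad U e = -(((T.filter fun e => e ∈ lCut U).card : ℝ) +
      ((T.filter fun e => e ∉ (yGraph n pad).edgeSet).card : ℝ)) := by
  classical
  simp only [ycoeff, sum_neg_distrib, sum_add_distrib, sum_boole]

/-- **Validity**: on every tour of the complete graph the functional of an odd `U` is at most
`-1` (a tour inside Yannakakis' graph restricts to a perfect matching of `L`, which crosses the
odd set `U`; any other tour pays the penalty). [cite: Yannakakis1991, proof of Thm. 2 (p. 454)] [cite: Rothvoss2017, §1 (PDF p. 4)] -/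
theorem sum_ycoeff_le {T : Finset (Sym2 (YV n pad))} (hT : IsTourOn T) {U : Finset (Fin n)}
    (hU : Odd U.card) : ∑ e ∈ T, ycoeff pad U e ≤ -1 := by
  classical
  rw [sum_ycoeff]
  by_cases hTG : ∀ e ∈ T, e ∈ (yGraph n pad).edgeSet
  · obtain ⟨e, he, hcr⟩ := hT.exists_lMatch_crossing hTG hU
    obtain ⟨a, b, rfl, ha, hb⟩ := crosses_iff_exists.1 hcr
    have hmem : (s(l a, l b) : Sym2 (YV n pad)) ∈ T.filter fun e => e ∈ lCut U :=
      mem_filter.2 ⟨(mk_mem_lMatch_iff.1 he).2, mem_lCut_iff.2 ⟨a, b, ha, hb, rfl⟩⟩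
    have h1 : (1 : ℝ) ≤ (T.filter fun e => e ∈ lCut U).card := by
      exact_mod_cast card_pos.2 ⟨_, hmem⟩
    have h2 : (0 : ℝ) ≤ (T.filter fun e => e ∉ (yGraph n pad).edgeSet).card := Nat.cast_nonneg _
    linarith
  · push Not at hTG
    obtain ⟨e, he, hne⟩ := hTG
    have h1 : (1 : ℝ) ≤ (T.filter fun e => e ∉ (yGraph n pad).edgeSet).card := by
      exact_mod_cast card_pos.2 ⟨e, mem_filter.2 ⟨he, hne⟩⟩
    have h2 : (0 : ℝ) ≤ (T.filter fun e => e ∈ lCut U).card := Nat.cast_nonneg _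
    linarith

variable {M : Finset (Sym2 (Fin n))} (hM : IsPMOn (Finset.univ : Finset (Fin n)) M)
include hM

/-- The crossing `L`-edges of `T_M` are the images of the crossing edges of `M`. [folklore] -/
theorem filter_ypTour_mem_lCut (hn : 0 < n) (U : Finset (Fin n)) :
    ((ypTour pad hM).filter fun e => e ∈ lCut U) = (M.filter (Crosses U)).image (Sym2.map YV.l) := by
  classical
  ext e
  simp only [mem_filter, mem_image, crosses_iff_exists]
  constructor
  · rintro ⟨heT, hecut⟩
    obtain ⟨a, b, ha, hb, rfl⟩ := mem_lCut_iff.1 hecut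
    have hab : a ≠ b := fun h => hb (h ▸ ha)
    have hM' : s(a, b) ∈ M := by
      rw [← lMatch_ypTour (pad := pad) hM hn]
      exact mk_mem_lMatch_iff.2 ⟨hab, heT⟩
    exact ⟨s(a, b), ⟨hM', a, b, rfl, ha, hb⟩, by simp⟩
  · rintro ⟨e', ⟨he'M, a, b, rfl, ha, hb⟩, rfl⟩
    have h1 : s(a, b) ∈ lMatch (ypTour pad hM) := by rwa [lMatch_ypTour hM hn]
    exact ⟨by simpa using (mk_mem_lMatch_iff.1 h1).2, mem_lCut_iff.2 ⟨a, b, ha, hb, by simp⟩⟩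

/-- **The value at the designated tour**: `Σ_{e ∈ T_M} ycoeff U e = -|δ(U) ∩ M|`, so the slack of
the inequality of `U` at `T_M` is `|δ(U) ∩ M| - 1` — Rothvoß's slack matrix `S_{UM}`.
[cite: Rothvoss2017, §2 (PDF p. 5: "S_{UM} = |M ∩ δ(U)| - 1")] -/
theorem sum_ycoeff_ypTour (hn : 0 < n) (U : Finset (Fin n)) :
    ∑ e ∈ ypTour pad hM, ycoeff pad U e = -((M.filter (Crosses U)).card : ℝ) := by
  classical
  rw [sum_ycoeff, filter_ypTour_mem_lCut hM hn,
    card_image_of_injective _ (Sym2.map.injective fun a b h => YV.l.inj h)]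
  have h0 : ((ypTour pad hM).filter fun e => e ∉ (yGraph n pad).edgeSet) = ∅ :=
    filter_false_of_mem fun e he => not_not.2 (ypTour_subset hM hn e he)
  rw [h0, card_empty, Nat.cast_zero, add_zero]

end OddCut

/-! ### Transport to `TSP(3n + pad)` -/

section Transport

/-- **The odd-cut slack data on `TSP(3n + pad)`** (Yannakakis' face, in slack form): there are
points `v_M ∈ TSP(3n + pad)` indexed by the perfect matchings `M` of `K_n` and inequalities
`c_U · x ≤ d_U` valid on `TSP(3n + pad)` indexed by the odd sets `U ⊆ [n]` whose slacks are
`d_U - c_U · v_M = |δ(U) ∩ M| - 1`. [cite: Yannakakis1991, Thm. 2 (p. 454)] [cite: Rothvoss2017, §1.1 and Cor. 2 (PDF p. 4), §2 (PDF p. 5)] -/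
theorem exists_matching_slack_data (n pad : ℕ) (hn : 0 < n) :
    ∃ (v : {M : Finset (Sym2 (Fin n)) // IsPMOn (Finset.univ : Finset (Fin n)) M} →
        (⊤ : SimpleGraph (Fin (3 * n + pad))).edgeSet → ℝ)
      (c : {U : Finset (Fin n) // Odd U.card} → (⊤ : SimpleGraph (Fin (3 * n + pad))).edgeSet → ℝ)
      (d : {U : Finset (Fin n) // Odd U.card} → ℝ),
      (∀ M, v M ∈ tspPolytope (3 * n + pad)) ∧
      (∀ U, ∀ x ∈ tspPolytope (3 * n + pad), c U ⬝ᵥ x ≤ d U) ∧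
      (∀ U M, d U - c U ⬝ᵥ v M = ((M.1.filter (Crosses U.1)).card : ℝ) - 1) := by
  classical
  set N := 3 * n + pad with hN
  let eqv : YV n pad ≃ Fin N := Fintype.equivFinOfCardEq (YV.card n pad)
  let c : {U : Finset (Fin n) // Odd U.card} → (⊤ : SimpleGraph (Fin N)).edgeSet → ℝ :=
    fun U ε => ycoeff pad U.1 (Sym2.map eqv.symm (ε : Sym2 (Fin N)))
  let Tb : {M : Finset (Sym2 (Fin n)) // IsPMOn (Finset.univ : Finset (Fin n)) M} → Finset (Sym2 (Fin N)) :=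
    fun M => (ypTour pad M.2).image (Sym2.map eqv)
  let v : {M : Finset (Sym2 (Fin n)) // IsPMOn (Finset.univ : Finset (Fin n)) M} →
      (⊤ : SimpleGraph (Fin N)).edgeSet → ℝ := fun M => charVec (Tb M)
  -- evaluation of `c U` on the characteristic vector of a tour of `K_N`
  have heval : ∀ (U : {U : Finset (Fin n) // Odd U.card}) (F : Finset (Sym2 (Fin N))),
      IsTourEdgeSet F →
        c U ⬝ᵥ charVec F = ∑ e ∈ F.image (Sym2.map eqv.symm), ycoeff pad U.1 e := by
    intro U F hF
    have hF' : IsTourOn F := hF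
    have h1 := dotProduct_charVec (fun x => ycoeff pad U.1 (Sym2.map eqv.symm x)) F
      (fun x hx => hF'.mem_edgeSet hx)
    rw [Finset.sum_image fun x _ y _ hxy => Sym2.map.injective eqv.symm.injective hxy]
    exact h1
  have himg : ∀ M : {M : Finset (Sym2 (Fin n)) // IsPMOn (Finset.univ : Finset (Fin n)) M},
      (Tb M).image (Sym2.map eqv.symm) = ypTour pad M.2 := by
    intro M
    simp only [Tb, Finset.image_image]
    have hcomp : (Sym2.map eqv.symm ∘ Sym2.map eqv : Sym2 (YV n pad) → Sym2 (YV n pad)) = id := by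
      funext e
      induction e using Sym2.ind with
      | h x y => simp
    rw [hcomp, Finset.image_id]
  refine ⟨v, c, fun _ => -1, fun M => ?_, fun U x hx => ?_, fun U M => ?_⟩
  · -- points
    exact charVec_mem_tspPolytope ((isTourOn_ypTour (pad := pad) M.2 hn).image_equiv eqv)
  · -- validity on all of `TSP(N)`
    have hconv : Convex ℝ {y : (⊤ : SimpleGraph (Fin N)).edgeSet → ℝ | c U ⬝ᵥ y ≤ -1} := by
      refine convex_halfSpace_le ⟨fun y z => dotProduct_add _ _ _, fun t y => ?_⟩ (-1)
      rw [dotProduct_smul, smul_eq_mul]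
    refine (convexHull_min ?_ hconv) hx
    rintro y ⟨F, hF, rfl⟩
    show c U ⬝ᵥ charVec F ≤ -1
    rw [heval U F hF]
    exact sum_ycoeff_le ((isTourOn_iff_isTourEdgeSet F).2 hF |>.image_equiv eqv.symm) U.2
  · -- value at the designated tours
    show -1 - c U ⬝ᵥ charVec (Tb M) = _
    rw [heval U (Tb M) ((isTourOn_ypTour (pad := pad) M.2 hn).image_equiv eqv), himg,
      sum_ycoeff_ypTour M.2 hn]
    ring

end Transport

end Literature.Barriers.PneNP
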